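import Summits.CriticalPhenomena.SAWScalingLimit.Theses.SAWRestrictionRigidity
import Literature.Probability.RandomPlanarGeometry.SimpleCurves
import Literature.Probability.RandomPlanarGeometry.ConformalRestrictionProofs
import Literature.Probability.RandomPlanarGeometry.FreelyJointedSAWCovariance

/-!
# Stub `stub_pushforwardCarried` of line `registered` (scalar / avoidance-cocycle cut), crux `Rigidity` (stmt-CriticalPhenomena-1368), route SAWRestrictionRigidity

Target: `Summits/CriticalPhenomena/SAWScalingLimit/Theorems/SAWRestrictionRigidityRigidityPushforwardCarried.lean` (`--supports stmt-CriticalPhenomena-1368`).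
-/

noncomputable section

namespace Summit.CriticalPhenomena.SAWScalingLimit.Cruxes.Rigidity.Cocycle

open MeasureTheory Set Filter Topology
open Literature.Probability.RandomPlanarGeometry

/-- The event "simple chord of `(D₂; a₂, b₂)` inside `closure D₂` meeting `∂D₂` only at the
marks" is Borel in curve space: simplicity is Borel (`CurveClass.measurableSet_simple'`), the
endpoint maps are continuous, staying inside a closed set is a closed event, and meeting the
closed set `∂D₂` only inside the closed set `{a₂, b₂}` is Borel
(`CurveClass.measurableSet_range_inter_subset`). [folklore] -/
theorem measurableSet_carried (S F : Set ℂ) (a b : ℂ) (hS : IsClosed S) (hF : IsClosed F) :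
    MeasurableSet {γ : CurveClass ℂ | γ ∈ CurveClass.simple ∧ γ.source = a ∧ γ.target = b ∧
      γ.range ⊆ S ∧ γ.range ∩ F ⊆ {a, b}} := by
  simp only [Set.setOf_and]
  refine MeasurableSet.inter ?_ (.inter ?_ (.inter ?_ (.inter ?_ ?_)))
  · rw [Set.setOf_mem_eq]
    exact CurveClass.measurableSet_simple'
  · exact CurveClass.continuous_source.measurable (measurableSet_singleton a)
  · exact CurveClass.continuous_target.measurable (measurableSet_singleton b)
  · exact CurveClass.measurableSet_rangeSubset hS
  · exact CurveClass.measurableSet_range_inter_subset hF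
      (((Set.finite_singleton b).insert a).isClosed)

/-- Pointwise transport: if `Φ` is injective on `S`, maps `S` into `S₂`, covers `F₂` by the image
of a part `F ⊆ S` (`F₂ ⊆ Φ '' F`), and sends the marks `a, b` to `a₂, b₂`, then a simple chord
from `a` to `b` inside `S` meeting `F` only inside `{a, b}` is pushed forward to a simple chord
from `a₂` to `b₂` inside `S₂` meeting `F₂` only inside `{a₂, b₂}`. [folklore] -/
theorem map_carried {S S₂ F F₂ : Set ℂ} {a b a₂ b₂ : ℂ} (Φ : C(ℂ, ℂ)) (hinj : Set.InjOn Φ S)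
    (hS : Φ '' S ⊆ S₂) (hFS : F ⊆ S) (hF : F₂ ⊆ Φ '' F) (ha : Φ a = a₂) (hb : Φ b = b₂)
    {γ : CurveClass ℂ}
    (hγ : γ ∈ CurveClass.simple ∧ γ.source = a ∧ γ.target = b ∧ γ.range ⊆ S ∧
      γ.range ∩ F ⊆ {a, b}) :
    CurveClass.map Φ γ ∈ CurveClass.simple ∧ (CurveClass.map Φ γ).source = a₂ ∧
      (CurveClass.map Φ γ).target = b₂ ∧ (CurveClass.map Φ γ).range ⊆ S₂ ∧
      (CurveClass.map Φ γ).range ∩ F₂ ⊆ {a₂, b₂} := by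
  obtain ⟨hs, hsrc, htgt, hrange, hfront⟩ := hγ
  refine ⟨?_, ?_, ?_, ?_, ?_⟩
  · obtain ⟨γ₀, hγ₀, rfl⟩ := hs
    rw [CurveClass.range_mk] at hrange
    have hγ₀' : Function.Injective γ₀ := hγ₀
    rw [CurveClass.map_mk]
    refine CurveClass.mk_mem_simple fun s t hst ↦ hγ₀' (hinj (hrange ⟨s, rfl⟩)
      (hrange ⟨t, rfl⟩) ?_)
    simpa only [Curve.map_apply] using hst
  · rw [CurveClass.source_map, hsrc, ha]
  · rw [CurveClass.target_map, htgt, hb]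
  · rw [CurveClass.range_map]
    exact (Set.image_mono hrange).trans hS
  · rw [CurveClass.range_map]
    rintro _ ⟨⟨x, hx, rfl⟩, hxF⟩
    obtain ⟨y, hy, hyx⟩ := hF hxF
    have hxy : y = x := hinj (hFS hy) (hrange hx) hyx
    rw [hxy] at hy
    rcases hfront ⟨hx, hy⟩ with h | h
    · rw [h, ha]
      exact Set.mem_insert _ _
    · rw [Set.mem_singleton_iff.1 h, hb]
      exact Set.mem_insert_of_mem _ (Set.mem_singleton _)

/-- **Push-forward of a law on simple boundary-avoiding chords** (stub 3 of line `registered`, crux `Rigidity`): along a continuous plane map injective on `closure D` carrying closure/frontier/marks of `D` onto those of `D₂`, a law carried by simple chords of `(D; a, b)` in `closure D` meeting `∂D` only at `a, b` is pushed to a law carried by simple chords of `(D₂; a₂, b₂)` with the same properties. [folklore] -/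
theorem stub_pushforwardCarried : ∀ (D D₂ : Literature.Probability.RandomPlanarGeometry.DobrushinDomain) (Φ : C(ℂ, ℂ)) (μ : MeasureTheory.Measure (Literature.Probability.RandomPlanarGeometry.CurveClass ℂ)), Set.InjOn Φ (closure D.carrier) → Φ '' closure D.carrier = closure D₂.carrier → Φ '' frontier D.carrier = frontier D₂.carrier → Φ (D.pt 0) = D₂.pt 0 → Φ (D.pt 1) = D₂.pt 1 → (∀ᵐ γ ∂μ, γ ∈ Literature.Probability.RandomPlanarGeometry.CurveClass.simple ∧ γ.source = D.pt 0 ∧ γ.target = D.pt 1 ∧ γ.range ⊆ closure D.carrier ∧ γ.range ∩ frontier D.carrier ⊆ {D.pt 0, D.pt 1}) → ∀ᵐ γ ∂(μ.map (Literature.Probability.RandomPlanarGeometry.CurveClass.map Φ)), γ ∈ Literature.Probability.RandomPlanarGeometry.CurveClass.simple ∧ γ.source = D₂.pt 0 ∧ γ.target = D₂.pt 1 ∧ γ.range ⊆ closure D₂.carrier ∧ γ.range ∩ frontier D₂.carrier ⊆ {D₂.pt 0, D₂.pt 1} := by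
  intro D D₂ Φ μ hinj hcl hfr h0 h1 hae
  refine (ae_map_iff (CurveClass.measurable_map Φ).aemeasurable
    (measurableSet_carried (closure D₂.carrier) (frontier D₂.carrier) (D₂.pt 0) (D₂.pt 1)
      isClosed_closure isClosed_frontier)).2 ?_
  filter_upwards [hae] with γ hγ
  exact map_carried Φ hinj hcl.subset frontier_subset_closure hfr.symm.subset h0 h1 hγ

end Summit.CriticalPhenomena.SAWScalingLimit.Cruxes.Rigidity.Cocycle

end
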